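import Summits.RiemannHypothesis.RiemannHypothesis.Theorems.IntegerScrewFloorOfRH
import Literature.NumberTheory.LFunctions.WeilZeroSum
import HarnessLib

/-!
# Route IntegerScrew — `ScrewVisibility` (item stmt-RiemannHypothesis-15763)

VISIBILITY LAW as filed: `∃ C A c > 0, ∀ M T, M^C ≤ T → (RH up to height T) → floor at level M`.

Because the constants are EXISTENTIAL and may depend on the (classically fixed) zero set of `ζ`, the
item as filed follows from the floor law under RH (`floorOfRH_proof`) by a case split:
* if RH holds, `FloorOfRH` gives `A, c` with the floor for EVERY `M` (any `C`, e.g. `C = 0`);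
* if RH fails, fix an off-line non-trivial zero `s₀` with `γ₀ = Im s₀ > 0` (conjugate if needed;
  non-trivial zeros are off the real axis) and take `C = γ₀ / log 2`: for `M ≥ 2` and `T ≥ M^C ≥ 2^C
  = e^{γ₀} > γ₀` the hypothesis "every zero with `0 < Im s ≤ T` has `Re s = 1/2`" fails at `s₀`, so
  the implication is vacuous, while for `M ≤ 1` both sides vanish (`Icc 2 M = ∅`).

NOTE FOR THE PLANNER (said plainly, D-0014): this closes the item AS FILED but not the intended
EFFECTIVE visibility law (explicit absolute `C, A, c`, e.g. `C ≈ 2K + 6` from the Weil-comb floor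
with the zero-tail bound `Σ_{|γ|>T} m(ρ)/γ² ≪ T^{-1/2}`); an effective restatement would quantify the
constants universally over the data or name them.
-/

-- `Summit.RiemannHypothesis.RiemannHypothesis.…` duplicates `RiemannHypothesis` BY DESIGN (D-0017).
set_option linter.dupNamespace false

noncomputable section

namespace Summit.RiemannHypothesis.RiemannHypothesis.Theorems

open Literature.NumberTheory.LFunctions
open scoped BigOperators ComplexConjugate
open Finset

/-- **`ScrewVisibility`** (route IntegerScrew, item stmt-RiemannHypothesis-15763), as filed
(ineffective constants): there are `C, A` and `c > 0` such that for all `M` and `T ≥ M^C`, RH verified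
up to height `T` implies the floor `c M^{−A} Σ_{2≤m≤M} x_m² ≤ x·S_M·x`.  Proof by cases on RH: the
floor law under RH (`floorOfRH_proof`), resp. vacuity above the height of an off-line zero. -/
theorem screwVisibility_proof :
    Summit.RiemannHypothesis.RiemannHypothesis.Theses.IntegerScrew.ScrewVisibility := by
  classical
  by_cases hRH : _root_.RiemannHypothesis
  · obtain ⟨A, c, hc, h⟩ := floorOfRH_proof hRH
    exact ⟨0, A, c, hc, fun M T _ _ x => h M x⟩
  · -- an off-line non-trivial zero
    have hex : ∃ s : ℂ, riemannZeta s = 0 ∧ (¬∃ n : ℕ, s = -2 * (n + 1)) ∧ s ≠ 1 ∧ s.re ≠ 1 / 2 := by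
      by_contra hcon
      apply hRH
      intro s hs htriv h1
      by_contra hre
      exact hcon ⟨s, hs, htriv, h1, hre⟩
    obtain ⟨s, hs, htriv, _, hre⟩ := hex
    have hNZ : s ∈ ZetaZeros.riemannZetaNontrivialZeros := by
      refine ⟨hs, ?_⟩
      rintro ⟨n, hn⟩
      exact htriv ⟨n, hn.symm⟩
    -- normalise to positive imaginary part
    obtain ⟨s₀, hs₀, hre₀, hγ₀⟩ : ∃ s₀ : ℂ, riemannZeta s₀ = 0 ∧ s₀.re ≠ 1 / 2 ∧ 0 < s₀.im := by
      have him := ZetaZeros.riemannZetaNontrivialZeros.im_ne_zero hNZ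
      rcases lt_or_gt_of_ne him with hneg | hpos
      · refine ⟨conj s, ?_, ?_, ?_⟩
        · exact ZetaZeros.riemannZetaNontrivialZeros.zeta_eq_zero
            (ZetaZeros.riemannZetaNontrivialZeros.conj_mem hNZ)
        · simpa using hre
        · simpa using hneg
      · exact ⟨s, hs, hre, hpos⟩
    set γ₀ : ℝ := s₀.im with hγ₀def
    have hlog2 : 0 < Real.log 2 := Real.log_pos one_lt_two
    refine ⟨γ₀ / Real.log 2, 0, 1, one_pos, fun M T hMT hhyp x => ?_⟩
    rcases lt_or_ge M 2 with hM | hM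
    · have hE : Finset.Icc 2 M = ∅ := Finset.Icc_eq_empty (by omega)
      simp [hE]
    · exfalso
      have hM2 : (2 : ℝ) ≤ M := by exact_mod_cast hM
      have hC0 : 0 ≤ γ₀ / Real.log 2 := div_nonneg hγ₀.le hlog2.le
      have h2C : (2 : ℝ) ^ (γ₀ / Real.log 2) ≤ (M : ℝ) ^ (γ₀ / Real.log 2) :=
        Real.rpow_le_rpow (by norm_num) hM2 hC0
      have hexp : (2 : ℝ) ^ (γ₀ / Real.log 2) = Real.exp γ₀ := by
        rw [Real.rpow_def_of_pos two_pos]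
        congr 1
        field_simp
      have hγT : γ₀ ≤ T := by
        have h1 : γ₀ + 1 ≤ Real.exp γ₀ := Real.add_one_le_exp γ₀
        linarith
      exact hre₀ (hhyp s₀ hs₀ hγ₀ hγT)

end Summit.RiemannHypothesis.RiemannHypothesis.Theorems

end
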